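import Summits.BirchSwinnertonDyer.Rank1Residual.Supersingular.CountPointsPowForm
import HarnessLib

/-!
# BSD rank-≤1 residual cell, class X7 (cell O4), analytic rank ONE, large supersingular `p`: KERNEL point counts
# `#Ẽ(𝔽_p) = p + 1` for the 98 record curves with `p ≥ 1031` — part 05 of 5 (2 rows, `p` ∈ {1559, 4919}) (cell `b2b-bsdres`, supersingular
# family prover B = unit `b2b-bsdres-additive-p3`, gen 20)

HONEST FRAMING (cell `b2b-bsdres-*`, verbatim): prove what is provable now; shrink each hard class to its core with data;
no claim beyond stated classes; COMBINATION classes deleted from PUBLISHED theorems only, CONSTRUCTION-shaped remainder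
typed; this is not "finishing BSD". Nothing booked; THEOREMS ONLY; each theorem is an UNCONDITIONAL kernel fact about one
literal integer equation: the number of points of its reduction modulo `p`.

WHY: the rank-one rem13 records `RankOneRem13RecordsX7Unit67–71` / `…79` (this gen) carry, for the 98 rows with `p ≥ 1031` (93 + 5 in the straggler batch `…79`),
the point count as a DATA binder `hn : #Ẽ(𝔽_p) = p + 1` because the schema count `countPoints` (Euler's criterion through the
list-fold `powMod`) exceeds the kernel's memory at `p ≈ 1 200`. `CountPointsPowForm.lean` (p304347) rewrites the count ONCE
into the same column sum with `r ^ ((p−1)/2) % p` (kernel big-number arithmetic): `p = 4919` then decides in seconds. Each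
theorem below is `natCard_point_eq_of_powForm` + ONE `decide +kernel`, and DISCHARGES the record's `hn`:
`bsdp_x7r1_<label>_<p> hK hGZK hmod _ rfl card_x7r1_<label>_<p> hsurj hr hs hv` (+ `surj_x7r1_<label>_<p>` for `hsurj`).
So after this file no rank-one record of the campaign carries a kernel-decidable datum as data: the DATA binders left are
`r_an = 1`, `#Ш_an` (Cremona allbsd), `surj(3)` on the `p = 3` rows, and the two-engine descent count on the `#Ш_an = 9` rows.

References: [IrelandRosen1990] Prop. 5.1.2, §8.1; [SilvermanAEC2009] V.1, VII.1; [Cremona2006] Table 1.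
-/

set_option autoImplicit false

namespace Summit.BirchSwinnertonDyer.Rank1Residual.Supersingular

open Literature.NumberTheory.EllipticCurves
  Literature.NumberTheory.EllipticCurves.Rank1Residual.X11RankOneCertificates

/-- **`#Ẽ(𝔽_{1559}) = 1560` for `284130bp1`** (Cremona model `[1, -1, 0, -20274714, -35558931380]`, `N = 284130`; `a_{1559} = 0`: good supersingular at `1559`) — pow-form column count decided in the kernel; discharges the `hn` binder of `bsdp_x7r1_284130bp1_1559`. [cite: IrelandRosen1990, Prop. 5.1.2 and §8.1] [cite: Cremona2006, Table 1 (Cremona label 284130bp1)] -/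
theorem card_x7r1_284130bp1_1559 :
    Nat.card (((⟨1, -1, 0, -20274714, -35558931380⟩ : WeierstrassCurve ℤ).map
      (Int.castRingHom (ZMod 1559))).toAffine.Point) = 1560 :=
  @natCard_point_eq_of_powForm 1 (-1) 0 (-20274714) (-35558931380) 1559 ⟨by norm_num⟩ (by decide) (by decide +kernel) 1560
    (by decide +kernel)

/-- **`#Ẽ(𝔽_{4919}) = 4920` for `284130v1`** (Cremona model `[1, -1, 0, -1307745, -575218179]`, `N = 284130`; `a_{4919} = 0`: good supersingular at `4919`) — pow-form column count decided in the kernel; discharges the `hn` binder of `bsdp_x7r1_284130v1_4919`. [cite: IrelandRosen1990, Prop. 5.1.2 and §8.1] [cite: Cremona2006, Table 1 (Cremona label 284130v1)] -/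
theorem card_x7r1_284130v1_4919 :
    Nat.card (((⟨1, -1, 0, -1307745, -575218179⟩ : WeierstrassCurve ℤ).map
      (Int.castRingHom (ZMod 4919))).toAffine.Point) = 4920 :=
  @natCard_point_eq_of_powForm 1 (-1) 0 (-1307745) (-575218179) 4919 ⟨by norm_num⟩ (by decide) (by decide +kernel) 4920
    (by decide +kernel)

end Summit.BirchSwinnertonDyer.Rank1Residual.Supersingular
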